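import Literature.NumberTheory.Irrationality.KrattenthalerZudilin2019.PiFourPiTwoForms
import HarnessLib

/-!
# Krattenthaler–Zudilin 2019, §4 eq. (8) at `n = 0` and `n = 1` — two INSTANCES of the named fact `rFour_eq_hypergeometric` (proofs only)

Topic `Literature/NumberTheory/Irrationality/KrattenthalerZudilin2019`; proofs-only companion of
`ZetaOddMinusPiPowers.lean` (objects `RFour`, `rFour`, `threeFTwoTerm`, `rFourHyp`; named fact
`rFour_eq_hypergeometric : ∀ n, rFour n = rFourHyp n`) and of `PiFourPiTwoForms.lean` (`rFour_one_holds`).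
Source: C. Krattenthaler, W. Zudilin, *Hypergeometry inspired by irrationality questions*, Kyushu J. Math. **73**
(2019) 189–203 [KrattenthalerZudilin2019], §4, eq. (8) and the display before it: "it turns out that
`r_n = π² (2n)!⁴/(4n+1)!² · ₃F₂(2n+1, 2n+1, 2n+1; 4n+2, 4n+2; 1)`", a consequence of the very-well-poised
non-terminating transformation (8) (the case `a = b = c = 2n+1` of Theorem 4 there), together with the printed
initial values "`r_0 = π⁴/6`, `r_1 = 19π⁴/6 − 125π²/4`".

## What is proved (0 sorry, no definition, no new named fact; net debt 0 — INSTANCES, NOT a discharge)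

The identity `rFour n = rFourHyp n` at the first two indices, each side evaluated independently:

* `threeFTwoTerm_zero`, `hasSum_threeFTwoTerm_zero`, `rFourHyp_zero`, `rFour_eq_rFourHyp_zero` — at `n = 0`
  the `₃F₂(1,1,1;2,2;1)` term is `1/(ν+1)²`, so the right-hand side is `π²·ζ(2) = π⁴/6 = r_0` (`rFour_zero`);
* `threeFTwoTerm_one` — at `n = 1` the term `((3)_ν)³/(((6)_ν)² ν!)` is the rational function
  `1800 (ν+1)(ν+2)/((ν+3)(ν+4)(ν+5))²` (Pochhammer products as factorial quotients);
* `hasSum_threeFTwoTerm_one` — `₃F₂(3,3,3;6,6;1) = 2850π² − 28125`, by the partial fractions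
  `(ν+1)(ν+2)/((ν+3)(ν+4)(ν+5))² = ½(ν+3)⁻² + 6(ν+4)⁻² + 3(ν+5)⁻² − (9/4)(ν+3)⁻¹ − 5(ν+4)⁻¹ + (29/4)(ν+5)⁻¹`
  (residues summing to `0`), Mathlib's `hasSum_zeta_two` shifted by `3, 4, 5`, and the two NONNEGATIVE
  telescoping series `Σ ((ν+3)⁻¹ − (ν+5)⁻¹) = 7/12`, `Σ ((ν+4)⁻¹ − (ν+5)⁻¹) = 1/4`;
* `rFourHyp_one : rFourHyp 1 = 19π⁴/6 − 125π²/4` and `rFour_eq_rFourHyp_one : rFour 1 = rFourHyp 1` — the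
  hypergeometric side reproduces the printed `r_1`, an exact cross-check of `rFour_one_holds`
  (`PiFourPiTwoForms.lean`, obtained there from the partial fractions of `R_1` and Lemma 1) through an
  INDEPENDENT formula; `rFour_eq_rFourHyp_of_le_one` packages both instances.

NOT done here: the general `n` (eq. (8) = Theorem 4 of the source at `a = b = c = 2n+1`, a non-terminating
very-well-poised `₅F₄ → ₃F₂` transformation); the named fact `rFour_eq_hypergeometric` stays OPEN.

HONEST FRAMING (cell pub-zeta5): systematic search; no irrationality claim unless kernel-certified — two
instances of a printed identity between `π²`/`π⁴` forms; special-function bookkeeping, nothing about `ζ(5)`.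
-/

open Finset Filter Topology

open scoped Nat

namespace Literature.NumberTheory.Irrationality.KrattenthalerZudilin2019

/-! ### Pochhammer products `(a)_ν = ∏_{j<ν}(a+j)` at `a = 1, 2, 3, 6` as factorial quotients -/

/-- `(1)_ν = ν!`. [folklore] -/
private theorem prod_range_one_add (ν : ℕ) : ∏ j ∈ range ν, ((1 : ℝ) + j) = (ν ! : ℝ) := by
  induction ν with
  | zero => simp
  | succ m ih =>
    rw [prod_range_succ, ih, Nat.factorial_succ]
    push_cast
    ring

/-- `(2)_ν = (ν+1)·ν!`. [folklore] -/
private theorem prod_range_two_add (ν : ℕ) :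
    ∏ j ∈ range ν, ((2 : ℝ) + j) = ((ν : ℝ) + 1) * ν ! := by
  induction ν with
  | zero => simp
  | succ m ih =>
    rw [prod_range_succ, ih, Nat.factorial_succ]
    push_cast
    ring

/-- `(3)_ν = (ν+1)(ν+2)·ν!/2`. [folklore] -/
private theorem prod_range_three_add (ν : ℕ) :
    ∏ j ∈ range ν, ((3 : ℝ) + j) = ((ν : ℝ) + 1) * ((ν : ℝ) + 2) * ν ! / 2 := by
  induction ν with
  | zero => norm_num [Nat.factorial]
  | succ m ih =>
    rw [prod_range_succ, ih, Nat.factorial_succ]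
    push_cast
    ring

/-- `(6)_ν = (ν+1)(ν+2)(ν+3)(ν+4)(ν+5)·ν!/120`. [folklore] -/
private theorem prod_range_six_add (ν : ℕ) :
    ∏ j ∈ range ν, ((6 : ℝ) + j) =
      ((ν : ℝ) + 1) * ((ν : ℝ) + 2) * ((ν : ℝ) + 3) * ((ν : ℝ) + 4) * ((ν : ℝ) + 5) * ν ! / 120 := by
  induction ν with
  | zero => norm_num [Nat.factorial]
  | succ m ih =>
    rw [prod_range_succ, ih, Nat.factorial_succ]
    push_cast
    ring

/-! ### `n = 0`: `₃F₂(1,1,1;2,2;1) = ζ(2)` and `r_0 = π⁴/6` from the hypergeometric side -/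

/-- At `n = 0` the term `((1)_ν)³/(((2)_ν)² ν!)` of `₃F₂(1,1,1;2,2;1)` is `1/(ν+1)²`.
[cite: KrattenthalerZudilin2019, §4 eq. (8)] -/
theorem threeFTwoTerm_zero (ν : ℕ) : threeFTwoTerm 0 ν = 1 / ((ν : ℝ) + 1) ^ 2 := by
  have e : threeFTwoTerm 0 ν =
      (∏ j ∈ range ν, ((1 : ℝ) + j)) ^ 3 / ((∏ j ∈ range ν, ((2 : ℝ) + j)) ^ 2 * ν !) := by
    unfold threeFTwoTerm
    norm_num
  rw [e, prod_range_one_add, prod_range_two_add]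
  have hf : (ν ! : ℝ) ≠ 0 := by positivity
  have hν : ((ν : ℝ) + 1) ≠ 0 := by positivity
  field_simp

/-- `₃F₂(1,1,1;2,2;1) = Σ_{ν ≥ 0} (ν+1)^{−2} = ζ(2) = π²/6`. [cite: KrattenthalerZudilin2019, §4 eq. (8)] -/
theorem hasSum_threeFTwoTerm_zero : HasSum (threeFTwoTerm 0) (Real.pi ^ 2 / 6) := by
  have h := (hasSum_nat_add_iff' (f := fun n : ℕ => 1 / (n : ℝ) ^ 2) 1).mpr hasSum_zeta_two
  have e : threeFTwoTerm 0 = fun n : ℕ => 1 / (((n + 1 : ℕ)) : ℝ) ^ 2 := by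
    funext ν
    rw [threeFTwoTerm_zero]
    push_cast
    ring
  rw [e]
  simpa using h

/-- The right-hand side of eq. (8) at `n = 0`: `π² · 0!⁴/1!² · ₃F₂(1,1,1;2,2;1) = π²·ζ(2) = π⁴/6`.
[cite: KrattenthalerZudilin2019, §4 eq. (8)] -/
theorem rFourHyp_zero : rFourHyp 0 = Real.pi ^ 4 / 6 := by
  rw [rFourHyp, hasSum_threeFTwoTerm_zero.tsum_eq]
  norm_num [Nat.factorial]
  ring

/-- **Eq. (8) at `n = 0`**: `r_0 = π² · 0!⁴/1!² · ₃F₂(1,1,1;2,2;1)` (both sides equal `π⁴/6`; left side: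
`rFour_zero` of the statement file). [cite: KrattenthalerZudilin2019, §4 eq. (8)] -/
theorem rFour_eq_rFourHyp_zero : rFour 0 = rFourHyp 0 := by
  rw [rFour_zero, rFourHyp_zero]

/-! ### `n = 1`: `₃F₂(3,3,3;6,6;1) = 2850π² − 28125` and `r_1 = 19π⁴/6 − 125π²/4` from the hypergeometric side -/

/-- At `n = 1` the term `((3)_ν)³/(((6)_ν)² ν!)` of `₃F₂(3,3,3;6,6;1)` is the rational function
`1800 (ν+1)(ν+2) / ((ν+3)(ν+4)(ν+5))²`. [cite: KrattenthalerZudilin2019, §4 eq. (8)] -/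
theorem threeFTwoTerm_one (ν : ℕ) :
    threeFTwoTerm 1 ν = 1800 * (((ν : ℝ) + 1) * ((ν : ℝ) + 2)) /
      (((ν : ℝ) + 3) * ((ν : ℝ) + 4) * ((ν : ℝ) + 5)) ^ 2 := by
  have e : threeFTwoTerm 1 ν =
      (∏ j ∈ range ν, ((3 : ℝ) + j)) ^ 3 / ((∏ j ∈ range ν, ((6 : ℝ) + j)) ^ 2 * ν !) := by
    unfold threeFTwoTerm
    norm_num
  rw [e, prod_range_three_add, prod_range_six_add]
  have hf : (ν ! : ℝ) ≠ 0 := by positivity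
  have h1 : ((ν : ℝ) + 1) ≠ 0 := by positivity
  have h2 : ((ν : ℝ) + 2) ≠ 0 := by positivity
  have h3 : ((ν : ℝ) + 3) ≠ 0 := by positivity
  have h4 : ((ν : ℝ) + 4) ≠ 0 := by positivity
  have h5 : ((ν : ℝ) + 5) ≠ 0 := by positivity
  field_simp
  ring

/-- `Σ_{ν ≥ 0} (ν+k)^{−2} = ζ(2) − Σ_{i<k} i^{−2}` (with Lean's `1/0² = 0` for the `i = 0` term), from Mathlib's
`hasSum_zeta_two`. [folklore] -/
private theorem hasSum_inv_sq_add (k : ℕ) :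
    HasSum (fun ν : ℕ => 1 / ((ν : ℝ) + k) ^ 2) (Real.pi ^ 2 / 6 - ∑ i ∈ range k, 1 / (i : ℝ) ^ 2) := by
  have h := (hasSum_nat_add_iff' (f := fun n : ℕ => 1 / (n : ℝ) ^ 2) k).mpr hasSum_zeta_two
  have e : (fun ν : ℕ => 1 / ((ν : ℝ) + k) ^ 2) = fun n : ℕ => 1 / (((n + k : ℕ)) : ℝ) ^ 2 := by
    funext ν
    push_cast
    ring
  rw [e]
  exact h

/-- Partial sums of the telescoping series: `Σ_{ν<M} ((ν+a)⁻¹ − (ν+a+1)⁻¹) = a⁻¹ − (M+a)⁻¹` (`a > 0`).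
[folklore] -/
private theorem sum_range_telescope (a : ℝ) (ha : 0 < a) (M : ℕ) :
    ∑ ν ∈ range M, (1 / ((ν : ℝ) + a) - 1 / ((ν : ℝ) + a + 1)) = 1 / a - 1 / ((M : ℝ) + a) := by
  induction M with
  | zero => simp
  | succ m ih =>
    rw [sum_range_succ, ih]
    have h1 : (m : ℝ) + a ≠ 0 := by positivity
    have h2 : (m : ℝ) + a + 1 ≠ 0 := by positivity
    have h3 : ((m + 1 : ℕ) : ℝ) + a ≠ 0 := by positivity
    push_cast
    field_simp
    ring

/-- The telescoping series `Σ_{ν ≥ 0} ((ν+a)⁻¹ − (ν+a+1)⁻¹) = a⁻¹` (`a > 0`; nonnegative terms, so the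
`HasSum` follows from the convergence of the partial sums). [folklore] -/
private theorem hasSum_telescope (a : ℝ) (ha : 0 < a) :
    HasSum (fun ν : ℕ => 1 / ((ν : ℝ) + a) - 1 / ((ν : ℝ) + a + 1)) (1 / a) := by
  refine (hasSum_iff_tendsto_nat_of_nonneg ?_ _).mpr ?_
  · intro ν
    have h1 : 0 < (ν : ℝ) + a := by positivity
    rw [sub_nonneg]
    exact one_div_le_one_div_of_le h1 (by linarith)
  · simp_rw [sum_range_telescope a ha]
    have h0 : Tendsto (fun M : ℕ => 1 / ((M : ℝ) + a)) atTop (𝓝 0) :=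
      tendsto_const_nhds.div_atTop (tendsto_natCast_atTop_atTop.atTop_add tendsto_const_nhds)
    have := (tendsto_const_nhds (x := 1 / a) (f := (atTop : Filter ℕ))).sub h0
    simpa using this

/-- `₃F₂(3,3,3;6,6;1) = Σ_{ν ≥ 0} 1800(ν+1)(ν+2)/((ν+3)(ν+4)(ν+5))² = 2850π² − 28125` (partial fractions,
`ζ(2) = π²/6` shifted by `3, 4, 5`, two telescoping series). [cite: KrattenthalerZudilin2019, §4 eq. (8)] -/
theorem hasSum_threeFTwoTerm_one : HasSum (threeFTwoTerm 1) (2850 * Real.pi ^ 2 - 28125) := by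
  have h3 := hasSum_inv_sq_add 3
  have h4 := hasSum_inv_sq_add 4
  have h5 := hasSum_inv_sq_add 5
  have s3 : ∑ i ∈ range 3, 1 / (i : ℝ) ^ 2 = 5 / 4 := by norm_num [Finset.sum_range_succ]
  have s4 : ∑ i ∈ range 4, 1 / (i : ℝ) ^ 2 = 49 / 36 := by norm_num [Finset.sum_range_succ]
  have s5 : ∑ i ∈ range 5, 1 / (i : ℝ) ^ 2 = 205 / 144 := by norm_num [Finset.sum_range_succ]
  rw [s3] at h3
  rw [s4] at h4
  rw [s5] at h5
  simp only [Nat.cast_ofNat] at h3 h4 h5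
  have t3 := hasSum_telescope 3 (by norm_num)
  have t4 := hasSum_telescope 4 (by norm_num)
  have big := ((((h3.mul_left (1 / 2)).add (h4.mul_left 6)).add (h5.mul_left 3)).sub
    (((t3.add t4).mul_left (9 / 4)).add (t4.mul_left 5))).mul_left 1800
  -- pointwise partial-fraction identity and the value bookkeeping
  have e : ∀ i : ℕ, threeFTwoTerm 1 i =
      1800 * (1 / 2 * (1 / ((i : ℝ) + 3) ^ 2) + 6 * (1 / ((i : ℝ) + 4) ^ 2) + 3 * (1 / ((i : ℝ) + 5) ^ 2) -
        (9 / 4 * (1 / ((i : ℝ) + 3) - 1 / ((i : ℝ) + 3 + 1) + (1 / ((i : ℝ) + 4) - 1 / ((i : ℝ) + 4 + 1))) +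
          5 * (1 / ((i : ℝ) + 4) - 1 / ((i : ℝ) + 4 + 1)))) := by
    intro i
    rw [threeFTwoTerm_one]
    have a1 : (i : ℝ) + 3 ≠ 0 := by positivity
    have a2 : (i : ℝ) + 4 ≠ 0 := by positivity
    have a3 : (i : ℝ) + 5 ≠ 0 := by positivity
    have a4 : (i : ℝ) + 3 + 1 ≠ 0 := by positivity
    have a5 : (i : ℝ) + 4 + 1 ≠ 0 := by positivity
    field_simp
    ring
  have v : (2850 * Real.pi ^ 2 - 28125 : ℝ) =
      1800 * (1 / 2 * (Real.pi ^ 2 / 6 - 5 / 4) + 6 * (Real.pi ^ 2 / 6 - 49 / 36) +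
        3 * (Real.pi ^ 2 / 6 - 205 / 144) - (9 / 4 * (1 / 3 + 1 / 4) + 5 * (1 / 4))) := by
    ring
  rw [show threeFTwoTerm 1 = _ from funext e, v]
  exact big

/-- The right-hand side of eq. (8) at `n = 1`: `π² · 2!⁴/5!² · ₃F₂(3,3,3;6,6;1) = π²(2850π² − 28125)/900
= 19π⁴/6 − 125π²/4` — the printed value of `r_1`. [cite: KrattenthalerZudilin2019, §4 eq. (8)] -/
theorem rFourHyp_one : rFourHyp 1 = 19 / 6 * Real.pi ^ 4 - 125 / 4 * Real.pi ^ 2 := by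
  rw [rFourHyp, hasSum_threeFTwoTerm_one.tsum_eq]
  norm_num [Nat.factorial]
  ring

/-- **Eq. (8) at `n = 1`**: `r_1 = π² · 2!⁴/5!² · ₃F₂(3,3,3;6,6;1)`: the hypergeometric side (`rFourHyp_one`)
and the well-poised side (`rFour_one_holds` of `PiFourPiTwoForms.lean`) both equal `19π⁴/6 − 125π²/4`.
[cite: KrattenthalerZudilin2019, §4 eq. (8)] -/
theorem rFour_eq_rFourHyp_one : rFour 1 = rFourHyp 1 := by
  rw [rFourHyp_one]
  exact rFour_one_holds

/-- Eq. (8) of the source (`rFour_eq_hypergeometric : ∀ n, rFour n = rFourHyp n`) holds at `n = 0` and `n = 1`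
(INSTANCES; the general `n` is Theorem 4 of the source and is not proved here).
[cite: KrattenthalerZudilin2019, §4 eq. (8)] -/
theorem rFour_eq_rFourHyp_of_le_one {n : ℕ} (hn : n ≤ 1) : rFour n = rFourHyp n := by
  interval_cases n
  · exact rFour_eq_rFourHyp_zero
  · exact rFour_eq_rFourHyp_one

end Literature.NumberTheory.Irrationality.KrattenthalerZudilin2019
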